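import Summits.Ventures.CertifiedArithmetic.LowPrec.DoubleRoundingFMAMiddle

/-!
# Double rounding of the FMA — the first binade above `W` decided exactly (THEOREM D-fma-M♯):
# the test

HONEST FRAMING: certified error envelopes and provably optimal rounding/accumulation schemes for
low-precision formats under stated cost models; every table by two implementations; no hardware
or vendor claims.

THEOREM D-fma-M (`DoubleRoundingFMAMiddle.lean`) decides the FMA of a `P_φ = m+1`-digit source
through a `P_ψ = m+n+1`-digit register (`2 P_φ ≤ P_ψ`, grids nested, `L_ψ ≤ 2 L_φ`,
`L_ψ + P_ψ ≤ L_φ`, `bias φ + 2m ≤ m_ψ + 1`) by the position of the source's largest finite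
value `M` against the left end `W = 2^(m+1+k)·quantum φ` (`k + m + bias φ = n + 1`) of window B —
under the side condition `fmaMidPairTest m n`, i.e. that the FIRST midpoint `W + h`
(`h = 2^k·quantum φ`) of the binade above `W` is a slip point.  This packet (three files) removes
the side condition on the whole first binade: for a source with `M = (2^m + J)·2^(k+1)` quanta,
`J ≤ 2^m` (largest value `W + 2J·h`, anywhere in `(W, 2W]`), and `n ≥ m + 2`,

  `DFma φ ψ ↔ fmaBinadeSlipTest m n J = false`     (`dFma_binade_iff`, `…BinadeIff.lean`)

where the test (this file) asks for a midpoint index `j < J` (`t = 2^m + j`), an offset count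
`e` with `|e| ≤ 2^(2m+2-n)` and the addend significand `w = 2t + 1 - e` in range
(`2^m ≤ w ≤ 2^(m+1) + 2J`, even once `w ≥ 2^(m+1)`), such that `|e·2^n + σ_t|` (`σ_t = +1` for
`t` even, `-1` for `t` odd) is a product of two `P_φ`-digit significands (`twoSigTest`).
THE ANATOMY (soundness, `binade_slip_sig` in `…BinadeFrame.lean`): a slip at `x = a·b + c > 0`
has `fl_ψ x = μ_t = (2t+1)·2^k·quantum φ`, the `t`-th midpoint of the binade (window A is empty
since `M ≤ 2^(m+k+2) ≤ 2^(m_ψ+1)`; window B starts at `W`); on `[W, 2W)` the register's spacing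
is `2·quantum φ²` and every quantity is a multiple of `quantum φ²`, so `x = μ_t ± quantum φ²`,
the sign forced by the parity of `t` (the midpoint itself and the far side round alike in `φ`);
the product `a·b = A·B·quantum φ²` then has `A·B` odd, so `|A|, |B| < 2^(m+1)`,
`|A·B| < 2^(2m+2) ≤ 2^(m+n)`, which puts `c` above `W/2`: `c = w·2^k·quantum φ` and
`A·B = e·2^n + σ_t`, `e = 2t + 1 - w`.  Completeness, the decision, the corollary `J = 1`
(= THEOREM D-fma-M's side condition) and the kernel instances are in `…BinadeIff.lean`.
PLACEMENT: innocuous double rounding [Figueroa1995] §3, [Roux2014] §2; FMA by rounding to odd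
[BoldoMelquiond2008] Thm 3; the midpoint property of a slip [MartinDorelMelquiondMuller2013]
Property 2.1; we found no record-level decision of the FMA through a `2P … 3P-2`-digit register
over a range of source maxima in the literature searched (queries in the cell's notes).
Implementation A: `code/enum/fma_binade_law.py` → `DOUBLE-ROUNDING-FMA.md` §14,
`certs/enum/DOUBLE-ROUNDING-FMA-BINADE.json`.  No hardware or vendor claims.
-/

namespace Summit.Ventures.CertifiedArithmetic

open Literature.ComputerArithmetic.FloatingPoint
open Literature.ComputerArithmetic.FloatingPoint.Format
open Literature.ComputerArithmetic.FloatingPoint.MiniFloat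

/-! ## §1 The test -/

/-- One candidate of the binade test: midpoint index `j` (`t = 2^m + j`, offset sign `σ = +1` for
`j` even, `-1` for `j` odd) and offset count `e`; the addend significand `w = 2t + 1 - e` must be a
`P_φ`-digit significand times `2^k` in range (`2^m ≤ w ≤ 2^(m+1) + 2J`, even once `w ≥ 2^(m+1)`)
and `|e·2^n + σ|` a product of two `P_φ`-digit significands. [this packet] -/
def fmaBinadeCond (m n J j : ℕ) (e : ℤ) : Bool :=
  decide ((2:ℤ) ^ m ≤ 2 * (2 ^ m + j) + 1 - e)
    && decide (2 * ((2:ℤ) ^ m + j) + 1 - e ≤ 2 ^ (m + 1) + 2 * J)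
    && (decide (2 * ((2:ℤ) ^ m + j) + 1 - e < 2 ^ (m + 1))
        || decide ((2 * ((2:ℤ) ^ m + j) + 1 - e) % 2 = 0))
    && twoSigTest (m + 1) (e * 2 ^ n + (if j % 2 = 0 then 1 else -1)).natAbs

/-- `fmaBinadeSlipTest m n J`: some midpoint `j < J` and offset count `|e| ≤ 2^(2m+2-n)` pass
`fmaBinadeCond` — the FMA of an `(m+1)`-digit source with `M = (2^m + J)·2^(k+1)` quanta through
an `(m+n+1)`-digit register slips somewhere. [this packet] -/
def fmaBinadeSlipTest (m n J : ℕ) : Bool :=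
  (List.range J).any fun j =>
    (List.range (2 * 2 ^ (2 * m + 2 - n) + 1)).any fun i =>
      fmaBinadeCond m n J j ((i : ℤ) - 2 ^ (2 * m + 2 - n))

/-- Reading a passing candidate back into the test. [this packet] -/
theorem fmaBinadeSlipTest_eq_true_of {m n J j : ℕ} {e : ℤ} (hj : j < J)
    (he : |e| ≤ 2 ^ (2 * m + 2 - n)) (h : fmaBinadeCond m n J j e = true) :
    fmaBinadeSlipTest m n J = true := by
  unfold fmaBinadeSlipTest
  rw [List.any_eq_true]
  refine ⟨j, List.mem_range.mpr hj, ?_⟩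
  rw [List.any_eq_true]
  have hE : (((2 ^ (2 * m + 2 - n) : ℕ) : ℤ)) = (2:ℤ) ^ (2 * m + 2 - n) := by push_cast; rfl
  rw [← hE] at he
  obtain ⟨he1, he2⟩ := abs_le.mp he
  refine ⟨(e + ((2 ^ (2 * m + 2 - n) : ℕ) : ℤ)).toNat, List.mem_range.mpr (by omega), ?_⟩
  rw [Int.toNat_of_nonneg (by omega)]
  convert h using 2; push_cast; ring

/-! ## §2 Two lemmas on significands -/

/-- An ODD magnitude is a bare significand: below `2^(m+1)`. [folklore] -/
theorem scaledMag_lt_of_odd {φ : Format} (x : MiniFloat φ) (h : Odd x.scaledMag) :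
    x.scaledMag < 2 ^ (φ.manBits + 1) := by
  obtain ⟨-, s, j, hs, hsj⟩ := representable_iff.mp (representable_scaledMag x)
  rcases Nat.eq_zero_or_pos j with hj | hj
  · rw [hsj, hj, pow_zero, mul_one]; exact hs
  · exfalso
    rw [hsj] at h
    exact (Nat.not_even_iff_odd.mpr h) ((Nat.even_pow.mpr ⟨even_two, hj.ne'⟩).mul_left s)

/-- A magnitude above `2^(m+g)` is a multiple of `2^g`: `N = w·2^g` with `w < 2^(m+1)` or `w` even
(`w = s·2^i`, `s < 2^(m+1)`). [folklore] -/
theorem exists_eq_mul_pow_of_lt {φ : Format} {N g : ℕ} (hN : φ.Representable N)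
    (hlt : 2 ^ (φ.manBits + g) < N) :
    ∃ w : ℕ, N = w * 2 ^ g ∧ (w < 2 ^ (φ.manBits + 1) ∨ w % 2 = 0) := by
  obtain ⟨-, s, j, hs, hsj⟩ := representable_iff.mp hN
  have hgj : g ≤ j := by
    by_contra hlt'
    have hj : j + 1 ≤ g := by omega
    have : N < 2 ^ (φ.manBits + g) :=
      calc N = s * 2 ^ j := hsj
        _ < 2 ^ (φ.manBits + 1) * 2 ^ j := Nat.mul_lt_mul_of_pos_right hs (by positivity)
        _ = 2 ^ (φ.manBits + (j + 1)) := by rw [← pow_add]; ring_nf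
        _ ≤ 2 ^ (φ.manBits + g) := Nat.pow_le_pow_right (by norm_num) (by omega)
    omega
  obtain ⟨i, rfl⟩ := Nat.exists_eq_add_of_le hgj
  refine ⟨s * 2 ^ i, by rw [hsj, pow_add]; ring, ?_⟩
  rcases Nat.eq_zero_or_pos i with hi | hi
  · left; rw [hi, pow_zero, mul_one]; exact hs
  · right; exact Nat.even_iff.mp ((Nat.even_pow.mpr ⟨even_two, hi.ne'⟩).mul_left s)

/-- `A·B + 1 ≤ P²` for `0 ≤ A, B ≤ P - 1`. [folklore] -/
theorem mul_add_one_le_mul_self {A B P : ℤ} (ha : A ≤ P - 1) (hb : B ≤ P - 1) (ha0 : 0 ≤ A)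
    (hb0 : 0 ≤ B) : A * B + 1 ≤ P * P := by
  nlinarith [mul_le_mul ha hb hb0 (by linarith : (0:ℤ) ≤ P - 1)]

end Summit.Ventures.CertifiedArithmetic
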